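import Summits.CriticalPhenomena.Ising3D.Control2DDiagonalStates
import Literature.Analysis.Asymptotics.KaramataTauberianMeasure
import Mathlib.MeasureTheory.Integral.Bochner.SumMeasure
import Mathlib.Analysis.SpecialFunctions.Pow.Asymptotics
import Mathlib.Analysis.SpecialFunctions.Pow.Continuity
import Mathlib.Tactic.Linarith
import Mathlib.Tactic.Positivity
import Mathlib.Tactic.FieldSimp
import Mathlib.Tactic.Ring
import HarnessLib

/-!
# The weighted spectral density, exactly: the Hardy–Littlewood (Karamata) Tauberian conclusion
# `F(E) ∼ (1 + 2P₀) E^{2Δ_σ}/Γ(2Δ_σ + 1)` of Pappadopulo–Rychkov–Espin–Rattazzi 2012 §4.2, for every unitary typed solution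
(cell `pub-ising3x`, seat controls-1 gen 45; PAPER §6.2 / Appendix E — CONTROL-ONLY; part 2 of 2, part 1 is
`Control2DDiagonalStates`; sequel to `Control2DCornerAsymptotics`)

HONEST FRAMING: lottery ticket; floor = tightest certified 3D Ising CFT bounds; no exact-solution
claim without a proof. CONTROL-ONLY (`d = 2`, global `sl(2) × sl(2)` blocks, `Δ_σ = s` an INPUT, axiom set
`A2D′`); nothing here is about `d = 3`, no certificate, functional or number of the record is touched, and no
new hypothesis or named fact enters.

WHAT THIS FILE ADDS. PRER 2012 §4.2 observe (4.7) `ℒ(β) ∼ β^{-2Δ_φ}` (`β → 0`) from the crossed channel and conclude, by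
«the Hardy-Littlewood tauberian theorem … surprisingly subtle to prove, if one wants to get the exact prefactor», that the
integrated weighted spectral density of the diagonal expansion obeys (4.9) `F(E) ∼ E^{2Δ_φ}/Γ(2Δ_φ+1)`.
`Control2DCornerAsymptotics` (E.1r) typed the INPUT (4.7) for the typed class — `((1-x)²)^s G(x,x) → 1 + 2P₀` at `x → 1⁻`,
`P₀ = Σ'_{Δ_i = 0} p_i` — and `Control2DDiagonalStates` typed the states `(i,m,m')` (weights `W = 2 p_i a_m(h_i) a_{m'}(h̄_i)`,
levels `E = Δ_i + m + m'`, `Σ W x^E = G(x,x) - 1`) and `F(E) = 1 + Σ'_{E_j ≤ E} W_j` (4.8). The Tauberian theorem is in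
the tree's Literature: `Literature.Analysis.Asymptotics.karamata_tauberian_measure_of_tendsto_rpow_mul` (W. Feller, An
Introduction to Probability Theory and Its Applications II, XIII.5 Theorem 2, direction (5.15) ⟹ (5.16) — Karamata's 1930
polynomial method carried out for an arbitrary measure `U` on `ℝ` with `U{(-∞,0)} = 0` and every index `ρ ≥ 0`). This
file composes the three:

* **`tendsto_tsum_le_div_rpow_of_tendsto`** — Feller XIII.5 Theorem 2 for a WEIGHTED atomic measure `U = Σ_j w_j δ_{E_j}`
  (`w_j, E_j ≥ 0`, `Σ_j w_j e^{-tE_j} < ∞` for `t > 0`, `ρ ≥ 0`): `t^ρ Σ_j w_j e^{-tE_j} → A` (`t ↓ 0`) implies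
  `(Σ'_{E_j ≤ T} w_j)/T^ρ → A/Γ(ρ+1)` (`T → ∞`) — measure bookkeeping only (`U` as a `Measure.sum` of Dirac masses over
  the countable support of `w`, `Summable.countable_support`; `U{(-∞,0)} = 0`; `∫ e^{-δx} U{dx} = Σ'_j w_j e^{-δE_j}` by
  Mathlib `integrable_sum_dirac_iff` / `integral_sum_dirac`; `U{(-∞,T]} = Σ'_{E_j ≤ T} w_j` by `ENNReal.tsum_toReal_eq`,
  `tsum_subtype`), then the Literature theorem BY NAME — no Tauberian step is re-proved;
* `CrossingData.tendsto_rpow_mul_laplace` — `t^{2s} Σ W e^{-tE} → 1 + 2P₀` as `t ↓ 0` (E.1r along `x = e^{-t}`, with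
  `t/(1 - e^{-t}) → 1` squeezed between `1` and `1 + t` by `Real.add_one_le_exp`, and `t^{2s} → 0`);
* **`CrossingData.tendsto_spectralCount_div_rpow (hU) (hC : SatisfiesCrossing s) (hs : 0 < s)`** —
  `F(E)/E^{2s} → (1 + 2P₀)/Γ(2s+1)` as `E → ∞`: PRER eq. (4.9) for EVERY unitary typed solution at `Δ_σ > 0` (two-sided:
  the weighted number of states of the diagonal expansion below `E` grows EXACTLY like `E^{2Δ_σ}`); `_of_pos`,
  `_of_hasScalarGap` (no weight at dimension `0` — any scalar gap `U > 0`, every class of the record — constant exactly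
  `1/Γ(2s+1)`, PRER's normalisation);
* **`CrossingData.eventually_tsum_p_le`** — the quasi-primaries alone: for every `ε > 0`, eventually
  `Σ'_{Δ_i ≤ E} p_i ≤ ((1 + 2P₀)/(2Γ(2s+1)) + ε) E^{2s}` (via `tsum_p_le_spectralCount` of part 1) — the constant of the
  hypothesis-free bound of `Control2DConvergenceRate` (E.1n: `½e^{2s}(E/(2s))^{2s} G(½,½)` for all `E ≥ 2s`) sharpened
  asymptotically to PRER's;
* `record_spectralCount (w)` — at `Δ_σ = 1/8` on the record's class: `F(E)/E^{1/4} → 1/Γ(5/4)` (labels `≥ 99/100`, so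
  `P₀ = 0` is proved, not assumed).

NOT claimed: PRER's error terms / the scale `E_HL` (their (4.10)–(4.11)); the `ρ`-coordinate form (their §4.3);
asymptotics of the PRIMARIES-only count beyond the upper bound `eventually_tsum_p_le` (the lower half of the asymptotics
belongs to primaries and descendants together); a bound on any single `p_i`; any statement at `s = 0`
(`Control2DZeroDimension`, E.1q, owns that edge); anything off the REAL diagonal; Virasoro; anything three-dimensional; any
new bound on a gap; no number of the record touched.

References: D. Pappadopulo, S. Rychkov, J. Espin, R. Rattazzi, Phys. Rev. D 86 (2012) 105043, §4.2 eq. (4.5)–(4.9)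
[cite: PappadopuloRychkovEspinRattazzi2012PRD, §4.2]; W. Feller, An Introduction to Probability Theory and Its
Applications II, 2nd ed., Wiley 1971, XIII.5 Theorem 2 [cite: Feller1971, XIII.5 Theorem 2]; R. Rattazzi, V. S. Rychkov,
E. Tonni, A. Vichi, JHEP 12 (2008) 031, §3 [cite: RattazziEtAl2008, §3]. Tree: `karamata_tauberian_measure_of_tendsto_rpow_mul`
(`Literature/Analysis/Asymptotics/KaramataTauberianMeasure`); `diagWeight`, `diagLevel`, `spectralCount`, `diagWeight_nonneg`,
`diagLevel_nonneg`, `hasSum_laplace`, `tsum_p_le_spectralCount` (`Control2DDiagonalStates`); `opeConvergent_free`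
(`Control2DOpeConvergenceFree`); `tendsto_fourPoint_corner` (`Control2DCornerAsymptotics`); `two_le_of_spin_ne_zero`,
`lowerBound_of_location`, `twoSided_2d_kernel099` (the record). Mathlib: `Measure.sum`, `Measure.sum_apply`,
`Measure.dirac_apply'`, `integrable_sum_dirac_iff`, `integral_sum_dirac`, `Summable.countable_support`,
`ENNReal.tsum_toReal_eq`, `tsum_subtype_eq_of_support_subset`, `tsum_subtype`, `Real.add_one_le_exp`,
`Real.continuous_rpow_const`, `tendsto_rpow_atTop`, `Filter.Tendsto.div_atTop`.
-/

namespace Summit.CriticalPhenomena.Ising3D.Control2D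

open Set Filter Topology MeasureTheory
open scoped ENNReal
open Literature.MathematicalPhysics.QuantumFieldTheory.ConformalBootstrap3D

/-! ### Karamata's Tauberian theorem for a weighted discrete family -/

section WeightedKaramata

variable {J : Type*} {w E : J → ℝ}

/-- **Karamata's Tauberian theorem for a weighted discrete family** (Feller XIII.5 Theorem 2 for the atomic
measure `U = Σ_j w_j δ_{E_j}`, no slowly varying factor): for `w_j ≥ 0`, `E_j ≥ 0` with `Σ_j w_j e^{-tE_j} < ∞` for
every `t > 0` and `0 ≤ ρ`, if `t^ρ Σ_j w_j e^{-tE_j} → A` as `t ↓ 0` then `(Σ'_{E_j ≤ T} w_j)/T^ρ → A/Γ(ρ+1)` as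
`T → ∞`. The measure-theoretic bookkeeping (`U` as a `Measure.sum` of Dirac masses over the countable support of `w`,
its Laplace transform and its distribution function as `tsum`s), then the Literature theorem BY NAME: via
`Literature.Analysis.Asymptotics.karamata_tauberian_measure_of_tendsto_rpow_mul`. [cite: Feller1971, XIII.5 Theorem 2] -/
theorem tendsto_tsum_le_div_rpow_of_tendsto (hw : ∀ j, 0 ≤ w j) (hE : ∀ j, 0 ≤ E j)
    (hsum : ∀ t : ℝ, 0 < t → Summable fun j => w j * Real.exp (-(t * E j))) {ρ A : ℝ} (hρ : 0 ≤ ρ)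
    (hlim : Tendsto (fun t : ℝ => t ^ ρ * ∑' j, w j * Real.exp (-(t * E j))) (𝓝[>] 0) (𝓝 A)) :
    Tendsto (fun T : ℝ => (∑' j : ↥({j : J | E j ≤ T} : Set J), w j) / T ^ ρ) atTop
      (𝓝 (A / Real.Gamma (ρ + 1))) := by
  classical
  -- the support of `w` is countable (a summable real family has countable support)
  have hcount : (Function.support w).Countable := by
    refine (hsum 1 one_pos).countable_support.mono fun j hj => ?_
    rw [Function.mem_support] at hj ⊢
    exact mul_ne_zero hj (Real.exp_pos _).ne'
  haveI : Countable ↥(Function.support w) := hcount.to_subtype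
  set μ : Measure ℝ := Measure.sum (fun j : ↥(Function.support w) =>
    ENNReal.ofReal (w j) • Measure.dirac (E j)) with hμdef
  -- `U` is concentrated on `[0, ∞)`
  have hsupp : μ (Iio 0) = 0 := by
    rw [hμdef, Measure.sum_apply _ measurableSet_Iio, ENNReal.tsum_eq_zero]
    intro j
    rw [Measure.smul_apply, smul_eq_mul, Measure.dirac_apply' _ measurableSet_Iio,
      indicator_of_notMem (by simpa using hE j), mul_zero]
  -- the Laplace transform exists and is the weighted sum
  have hint : ∀ δ : ℝ, 0 < δ → Integrable (fun x => Real.exp (-(δ * x))) μ := by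
    intro δ hδ
    rw [hμdef, integrable_sum_dirac_iff (fun _ => ENNReal.ofReal_ne_top)]
    refine ((hsum δ hδ).subtype _).congr fun j => ?_
    simp only [Function.comp_apply]
    rw [ENNReal.toReal_ofReal (hw j), Real.norm_eq_abs, abs_of_pos (Real.exp_pos _)]
  have hω' : ∀ δ : ℝ, ∫ x, Real.exp (-(δ * x)) ∂μ = ∑' j, w j * Real.exp (-(δ * E j)) := by
    intro δ
    rw [hμdef, integral_sum_dirac (fun _ => ENNReal.ofReal_ne_top)]
    have h3 : ∀ j : ↥(Function.support w),
        (ENNReal.ofReal (w (j : J))).toReal • Real.exp (-(δ * E (j : J))) =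
          w j * Real.exp (-(δ * E (j : J))) := fun j => by
      rw [ENNReal.toReal_ofReal (hw j), smul_eq_mul]
    rw [tsum_congr h3]
    exact tsum_subtype_eq_of_support_subset (f := fun j => w j * Real.exp (-(δ * E j)))
      fun j hj => left_ne_zero_of_mul hj
  have hω : Tendsto (fun δ : ℝ => δ ^ ρ * ∫ x, Real.exp (-(δ * x)) ∂μ) (𝓝[>] 0) (𝓝 A) := by
    refine hlim.congr' (Eventually.of_forall fun δ => ?_)
    simp only [hω' δ]
  -- the distribution function is the weighted count
  have hIic : ∀ T : ℝ, μ.real (Iic T) = ∑' j : ↥({j : J | E j ≤ T} : Set J), w j := by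
    intro T
    rw [measureReal_def, hμdef, Measure.sum_apply _ measurableSet_Iic]
    have hterm : ∀ j : ↥(Function.support w),
        (ENNReal.ofReal (w (j : J)) • Measure.dirac (E (j : J))) (Iic T) =
          ENNReal.ofReal (({j : J | E j ≤ T} : Set J).indicator w j) := by
      intro j
      rw [Measure.smul_apply, smul_eq_mul, Measure.dirac_apply' _ measurableSet_Iic]
      by_cases hj : E (j : J) ≤ T
      · rw [indicator_of_mem (show E (j : J) ∈ Iic T from hj),
          indicator_of_mem (show (j : J) ∈ ({j : J | E j ≤ T} : Set J) from hj), Pi.one_apply, mul_one]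
      · rw [indicator_of_notMem (show E (j : J) ∉ Iic T from hj),
          indicator_of_notMem (show (j : J) ∉ ({j : J | E j ≤ T} : Set J) from hj), mul_zero,
          ENNReal.ofReal_zero]
    rw [tsum_congr hterm, ENNReal.tsum_toReal_eq (fun _ => ENNReal.ofReal_ne_top)]
    have hterm2 : ∀ j : ↥(Function.support w),
        (ENNReal.ofReal (({j : J | E j ≤ T} : Set J).indicator w (j : J))).toReal =
          ({j : J | E j ≤ T} : Set J).indicator w (j : J) := fun j =>
      ENNReal.toReal_ofReal (indicator_nonneg (fun _ _ => hw _) _)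
    rw [tsum_congr hterm2, tsum_subtype_eq_of_support_subset (f := ({j : J | E j ≤ T} : Set J).indicator w)
      (by rw [Set.support_indicator]; exact Set.inter_subset_right), tsum_subtype]
  have h := Literature.Analysis.Asymptotics.karamata_tauberian_measure_of_tendsto_rpow_mul hρ hsupp hint hω
  refine h.congr' (Eventually.of_forall fun T => ?_)
  rw [hIic]

end WeightedKaramata

/-! ### The Tauberian input along `x = e^{-t}` and the conclusion -/

namespace CrossingData

variable {D : CrossingData} {s : ℝ}

/-- **PRER (4.7) in the Laplace variable**: for every unitary solution of the typed sum rule at `Δ_σ = s > 0`,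
`t^{2s} · Σ_{(i,m,m')} W e^{-tE} → 1 + 2·Σ'_{Δ_i = 0} p_i` as `t ↓ 0` — `Control2DCornerAsymptotics.tendsto_fourPoint_corner`
along `x = e^{-t}`, with `t/(1 - e^{-t}) → 1` (squeezed between `1` and `1 + t`) and `t^{2s} → 0`.
[cite: PappadopuloRychkovEspinRattazzi2012PRD, §4.2] -/
theorem tendsto_rpow_mul_laplace (hU : D.IsUnitary) (hC : D.SatisfiesCrossing s) (hs : 0 < s) :
    Tendsto (fun t : ℝ => t ^ (2 * s) * ∑' j : D.ι × ℕ × ℕ, D.diagWeight j * Real.exp (-(t * D.diagLevel j)))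
      (𝓝[>] 0) (𝓝 (1 + 2 * ∑' i : ↥({i : D.ι | D.Δ i = 0} : Set D.ι), D.p i)) := by
  set L : ℝ := 1 + 2 * ∑' i : ↥({i : D.ι | D.Δ i = 0} : Set D.ι), D.p i with hL
  have hconv := opeConvergent_free hU hC hs
  have hden : ∀ t : ℝ, 0 < t → 0 < 1 - Real.exp (-t) := fun t ht => by
    have := Real.exp_lt_one_iff.mpr (show -t < 0 by linarith)
    linarith
  -- `x = e^{-t}` maps `𝓝[>] 0` into `𝓝[<] 1`
  have hφ : Tendsto (fun t : ℝ => Real.exp (-t)) (𝓝[>] 0) (𝓝[<] 1) := by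
    refine tendsto_nhdsWithin_of_tendsto_nhds_of_eventually_within _ ?_ ?_
    · have h0 : Tendsto (fun t : ℝ => Real.exp (-t)) (𝓝 0) (𝓝 (Real.exp (-0))) :=
        (Real.continuous_exp.comp continuous_neg).tendsto 0
      rw [neg_zero, Real.exp_zero] at h0
      exact h0.mono_left nhdsWithin_le_nhds
    · filter_upwards [self_mem_nhdsWithin] with t ht
      exact Real.exp_lt_one_iff.mpr (by simpa using ht)
  have A : Tendsto (fun t : ℝ => ((1 - Real.exp (-t)) * (1 - Real.exp (-t))) ^ s *
      D.fourPoint (Real.exp (-t)) (Real.exp (-t))) (𝓝[>] 0) (𝓝 L) :=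
    (tendsto_fourPoint_corner hU hC hs).comp hφ
  -- `t/(1 - e^{-t}) → 1`
  have hr : Tendsto (fun t : ℝ => t / (1 - Real.exp (-t))) (𝓝[>] 0) (𝓝 1) := by
    have hup : Tendsto (fun t : ℝ => 1 + t) (𝓝[>] 0) (𝓝 1) := by
      have h0 : Tendsto (fun t : ℝ => 1 + t) (𝓝 0) (𝓝 (1 + 0)) := (continuous_const.add continuous_id).tendsto 0
      rw [add_zero] at h0
      exact h0.mono_left nhdsWithin_le_nhds
    refine tendsto_of_tendsto_of_tendsto_of_le_of_le' tendsto_const_nhds hup ?_ ?_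
    · filter_upwards [self_mem_nhdsWithin] with t ht
      have ht0 : 0 < t := ht
      rw [le_div_iff₀ (hden t ht0), one_mul]
      linarith [Real.add_one_le_exp (-t)]
    · filter_upwards [self_mem_nhdsWithin] with t ht
      have ht0 : 0 < t := ht
      rw [div_le_iff₀ (hden t ht0)]
      have h1 := Real.add_one_le_exp t
      have h3 : 0 < Real.exp (-t) := Real.exp_pos _
      have h2 : Real.exp t * Real.exp (-t) = 1 := by rw [← Real.exp_add, add_neg_cancel, Real.exp_zero]
      have h4 : (t + 1) * Real.exp (-t) ≤ Real.exp t * Real.exp (-t) := mul_le_mul_of_nonneg_right h1 h3.le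
      rw [h2] at h4
      nlinarith
  have hr2 : Tendsto (fun t : ℝ => (t / (1 - Real.exp (-t)) * (t / (1 - Real.exp (-t)))) ^ s)
      (𝓝[>] 0) (𝓝 1) := by
    have hc : Tendsto (fun y : ℝ => (y * y) ^ s) (𝓝 1) (𝓝 (((1 : ℝ) * 1) ^ s)) :=
      ((Real.continuous_rpow_const hs.le).comp (continuous_id.mul continuous_id)).tendsto 1
    rw [mul_one, Real.one_rpow] at hc
    exact hc.comp hr
  have hz : Tendsto (fun t : ℝ => t ^ (2 * s)) (𝓝[>] 0) (𝓝 0) := by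
    have hc : Tendsto (fun t : ℝ => t ^ (2 * s)) (𝓝 0) (𝓝 ((0 : ℝ) ^ (2 * s))) :=
      (Real.continuous_rpow_const (by linarith)).tendsto 0
    rw [Real.zero_rpow (by linarith)] at hc
    exact hc.mono_left nhdsWithin_le_nhds
  have hmain := (hr2.mul A).sub hz
  rw [one_mul, sub_zero] at hmain
  refine hmain.congr' ?_
  filter_upwards [self_mem_nhdsWithin] with t ht
  have ht0 : 0 < t := ht
  have hd := hden t ht0
  have hrt : 0 < t / (1 - Real.exp (-t)) := div_pos ht0 hd
  rw [(hasSum_laplace hU hconv ht0).tsum_eq]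
  have key : (t / (1 - Real.exp (-t)) * (t / (1 - Real.exp (-t)))) ^ s *
      ((1 - Real.exp (-t)) * (1 - Real.exp (-t))) ^ s = t ^ (2 * s) := by
    rw [← Real.mul_rpow (mul_nonneg hrt.le hrt.le) (mul_nonneg hd.le hd.le)]
    have e1 : t / (1 - Real.exp (-t)) * (t / (1 - Real.exp (-t))) * ((1 - Real.exp (-t)) * (1 - Real.exp (-t))) =
        t * t := by
      field_simp
    rw [e1, show t * t = t ^ (2 : ℕ) by ring, ← Real.rpow_natCast, ← Real.rpow_mul ht0.le]
    norm_num
  show (t / (1 - Real.exp (-t)) * (t / (1 - Real.exp (-t)))) ^ s *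
      (((1 - Real.exp (-t)) * (1 - Real.exp (-t))) ^ s * D.fourPoint (Real.exp (-t)) (Real.exp (-t))) -
      t ^ (2 * s) = t ^ (2 * s) * (D.fourPoint (Real.exp (-t)) (Real.exp (-t)) - 1)
  rw [← mul_assoc, key]
  ring

/-- **The weighted spectral density, exactly — the Tauberian conclusion of PRER 2012 §4.2, eq. (4.9), for the typed
class.** For every unitary solution of the typed `⟨σσσσ⟩` sum rule at `Δ_σ = s > 0`:
`F(E)/E^{2s} → (1 + 2·Σ'_{Δ_i = 0} p_i)/Γ(2s+1)` as `E → ∞`, where `F = spectralCount` is the integrated weighted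
spectral density of the diagonal expansion (4.8). Karamata's Tauberian theorem (Feller XIII.5 Theorem 2, the tree's
`karamata_tauberian_measure_of_tendsto_rpow_mul`) applied to the input `tendsto_rpow_mul_laplace` (E.1r); the vacuum's
unit weight contributes `1/E^{2s} → 0`. Two-sided: the weighted number of states of the diagonal expansion below `E`
grows EXACTLY like `E^{2Δ_σ}`. [cite: PappadopuloRychkovEspinRattazzi2012PRD, §4.2 eq. (4.9)] -/
theorem tendsto_spectralCount_div_rpow (hU : D.IsUnitary) (hC : D.SatisfiesCrossing s) (hs : 0 < s) :
    Tendsto (fun E : ℝ => D.spectralCount E / E ^ (2 * s)) atTop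
      (𝓝 ((1 + 2 * ∑' i : ↥({i : D.ι | D.Δ i = 0} : Set D.ι), D.p i) / Real.Gamma (2 * s + 1))) := by
  have hconv := opeConvergent_free hU hC hs
  have K := tendsto_tsum_le_div_rpow_of_tendsto (diagWeight_nonneg hU) (diagLevel_nonneg hU)
    (fun t ht => (hasSum_laplace hU hconv ht).summable) (by linarith : 0 ≤ 2 * s)
    (tendsto_rpow_mul_laplace hU hC hs)
  have Z : Tendsto (fun E : ℝ => 1 / E ^ (2 * s)) atTop (𝓝 0) :=
    tendsto_const_nhds.div_atTop (tendsto_rpow_atTop (by linarith))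
  have h := Z.add K
  rw [zero_add] at h
  refine h.congr' (Eventually.of_forall fun E => ?_)
  show 1 / E ^ (2 * s) +
      (∑' j : ↥({j : D.ι × ℕ × ℕ | D.diagLevel j ≤ E} : Set (D.ι × ℕ × ℕ)), D.diagWeight j) / E ^ (2 * s) =
    D.spectralCount E / E ^ (2 * s)
  rw [spectralCount, add_div]

/-- Data with no weight at dimension zero have `Σ'_{Δ_i = 0} p_i = 0`. [folklore] -/
theorem tsum_p_dim_zero_eq_zero (hpos : ∀ i, D.p i ≠ 0 → 0 < D.Δ i) :
    ∑' i : ↥({i : D.ι | D.Δ i = 0} : Set D.ι), D.p i = 0 := by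
  have hterm : ∀ i : ↥({i : D.ι | D.Δ i = 0} : Set D.ι), D.p i = 0 := fun i => by
    by_contra hp
    have h1 := hpos i hp
    have hi : D.Δ (i : D.ι) = 0 := i.2
    linarith
  rw [tsum_congr hterm, tsum_zero]

/-- **No weight at dimension zero: `F(E)/E^{2s} → 1/Γ(2s+1)`** — PRER (4.9) with their normalisation exactly
(`F(E) ∼ E^{2Δ_φ}/Γ(2Δ_φ+1)`), for every unitary solution of the typed sum rule at `s > 0` all of whose weighted
labels have positive dimension (any scalar gap; every class of the record). [cite: PappadopuloRychkovEspinRattazzi2012PRD, §4.2 eq. (4.9)] -/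
theorem tendsto_spectralCount_div_rpow_of_pos (hU : D.IsUnitary) (hC : D.SatisfiesCrossing s) (hs : 0 < s)
    (hpos : ∀ i, D.p i ≠ 0 → 0 < D.Δ i) :
    Tendsto (fun E : ℝ => D.spectralCount E / E ^ (2 * s)) atTop (𝓝 (1 / Real.Gamma (2 * s + 1))) := by
  have h := tendsto_spectralCount_div_rpow hU hC hs
  rw [tsum_p_dim_zero_eq_zero hpos, mul_zero, add_zero] at h
  exact h

/-- **Under a scalar gap `U > 0`: `F(E)/E^{2s} → 1/Γ(2s+1)`** (scalars have `Δ ≥ U > 0`, spinning labels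
`Δ ≥ ℓ ≥ 2`). [cite: PappadopuloRychkovEspinRattazzi2012PRD, §4.2 eq. (4.9)] -/
theorem tendsto_spectralCount_div_rpow_of_hasScalarGap (hU : D.IsUnitary) (hC : D.SatisfiesCrossing s)
    (hs : 0 < s) {U : ℝ} (hgap : D.HasScalarGap U) (hU0 : 0 < U) :
    Tendsto (fun E : ℝ => D.spectralCount E / E ^ (2 * s)) atTop (𝓝 (1 / Real.Gamma (2 * s + 1))) := by
  refine tendsto_spectralCount_div_rpow_of_pos hU hC hs fun i _ => ?_
  by_cases h0 : D.spin i = 0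
  · exact lt_of_lt_of_le hU0 (hgap i h0)
  · exact lt_of_lt_of_le (by norm_num) (two_le_of_spin_ne_zero hU h0)

/-! ### The primaries alone, asymptotically -/

/-- **Asymptotic density of the quasi-primaries.** For every unitary solution of the typed sum rule at `Δ_σ = s > 0`
and every `ε > 0`: eventually (as `E → ∞`) `Σ'_{Δ_i ≤ E} p_i ≤ ((1 + 2·Σ'_{Δ_i = 0} p_i)/(2Γ(2s+1)) + ε) · E^{2s}` —
the constant of the hypothesis-free bound `Control2DConvergenceRate.sum_p_low_le` (`½e^{2s}(E/(2s))^{2s} G(½,½)`,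
all `E ≥ 2s`) sharpened asymptotically to PRER's (4.9). Only an UPPER bound: the lower half of the asymptotics belongs
to primaries and descendants together. [cite: PappadopuloRychkovEspinRattazzi2012PRD, §4.2] -/
theorem eventually_tsum_p_le (hU : D.IsUnitary) (hC : D.SatisfiesCrossing s) (hs : 0 < s) {ε : ℝ} (hε : 0 < ε) :
    ∀ᶠ E : ℝ in atTop, ∑' i : ↥({i : D.ι | D.Δ i ≤ E} : Set D.ι), D.p i ≤
      ((1 + 2 * ∑' i : ↥({i : D.ι | D.Δ i = 0} : Set D.ι), D.p i) / (2 * Real.Gamma (2 * s + 1)) + ε) *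
        E ^ (2 * s) := by
  set c : ℝ := (1 + 2 * ∑' i : ↥({i : D.ι | D.Δ i = 0} : Set D.ι), D.p i) / Real.Gamma (2 * s + 1) with hc
  have h := tendsto_spectralCount_div_rpow hU hC hs
  have hev := (Metric.tendsto_nhds.mp h) (2 * ε) (by positivity)
  filter_upwards [hev, eventually_gt_atTop 0] with E hE hE0
  set X : ℝ := E ^ (2 * s) with hX
  have hXpos : 0 < X := Real.rpow_pos_of_pos hE0 _
  rw [Real.dist_eq, abs_lt] at hE
  have h2 : D.spectralCount E < (c + 2 * ε) * X := by
    have h3 : D.spectralCount E / X < c + 2 * ε := by linarith [hE.2]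
    exact (div_lt_iff₀ hXpos).mp h3
  have h4 := tsum_p_le_spectralCount hU (opeConvergent_free hU hC hs) E
  rw [div_mul_eq_div_div_swap, ← hc]
  nlinarith [h2, h4, hXpos, hε]

end CrossingData

/-! ### The record's class at `Δ_σ = 1/8` -/

/-- **At `Δ_σ = 1/8`, for every datum of the record's class** (unitary, typed sum rule, spin 2 in `{2} ∪ [3,∞)`,
scalars in `{x} ∪ [2,∞)` with `w ≤ x`, hence all labels `≥ 0.99` by `twoSided_2d_kernel099`): the integrated weighted
spectral density of the diagonal expansion obeys `F(E)/E^{1/4} → 1/Γ(5/4)` as `E → ∞` — PRER (4.9) at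
`2Δ_φ = 1/4`. CONTROL-ONLY; no certificate or number of the record is touched. [folklore] -/
theorem record_spectralCount (w : ℝ) (D : CrossingData) (hU : D.IsUnitary) (hC : D.SatisfiesCrossing (1 / 8))
    (hT : D.SpinTwoIn ({2} ∪ Ici (2 + 1))) (x : ℝ) (hwx : w ≤ x) (hS : D.ScalarsIn ({x} ∪ Ici 2)) :
    Tendsto (fun E : ℝ => D.spectralCount E / E ^ (1 / 4 : ℝ)) atTop (𝓝 (1 / Real.Gamma (5 / 4))) := by
  have hx : (99 / 100 : ℝ) < x := ((twoSided_2d_kernel099 w) D hU hC hT x hwx hS).1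
  have hτ : ∀ i, (99 / 100 : ℝ) ≤ D.Δ i := fun i =>
    le_trans (le_min (le_min hx.le (by norm_num)) (by norm_num)) (CrossingData.lowerBound_of_location hU hS i)
  have hpos : ∀ i, D.p i ≠ 0 → 0 < D.Δ i := fun i _ => lt_of_lt_of_le (by norm_num) (hτ i)
  have h := CrossingData.tendsto_spectralCount_div_rpow_of_pos hU hC (by norm_num) hpos
  have e1 : (2 : ℝ) * (1 / 8) = 1 / 4 := by norm_num
  have e2 : (2 : ℝ) * (1 / 8) + 1 = 5 / 4 := by norm_num
  rw [e2] at h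
  simp only [e1] at h
  exact h

end Summit.CriticalPhenomena.Ising3D.Control2D
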